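import Literature.Computability.Complexity.TimeHierarchyInterpreter
import Literature.Computability.Complexity.TM2ToStackProgram
import HarnessLib

/-!
# The deterministic time hierarchy theorem — proof file of `TimeSpace.lean` (`time_hierarchy`)

Sibling proof file discharging the named fact `Literature.Computability.Complexity.time_hierarchy`
(`TimeSpace.lean`, **pnp.S13**: for time-constructible `T`, `U` with `T(n)² / U(n) → 0`,
`DTIME T ⊂ DTIME U`; Hartmanis–Stearns 1965, Thm. 9 / Cor. 9.1; Arora–Barak 2009, Thm. 3.1), by
assembling the three layers

* `TimeHierarchyDiagonal.lean` — the diagonal argument over a fuelled universal decider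
  (`FuelledSimulator`, `time_hierarchy_of_fuelledSimulator`);
* `TimeHierarchyMeter.lean` — the time counter: a fuelled universal decider from any correct
  unclocked interpreter (`FuelledRun.Interprets`, `FuelledRun.time_hierarchy_of_interpreter`);
* `TimeHierarchyInterpreter.lean` — the interpreter `UDet.interp` of uniform flat programs with
  its effect and cost on well-formed inputs (`UDet.runs_interp`),

with the tree's normal form of machines (`TM2ToStackProgram.lean`: every
`M : Turing.TM2ComputableAux Bool Bool` is a flat binary stack program with linear overhead, here
re-derived with the input register numbered `0`, `TM2Flat.exists_aprogFin0_of_outputsWithin`) and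
the step-for-step uniform translation `UFlat.toUProg` (`FlatTranscripts.lean`):
**`UDet.interprets`** (the interpreter is correct with quadratic overhead: Arora–Barak 2009,
Thm. 1.9 in the relaxed `C T²` form) and **`time_hierarchy_holds`**.

## References

* J. Hartmanis, R. E. Stearns, *On the computational complexity of algorithms*, Trans. Amer.
  Math. Soc. 117 (1965) 285–306, Thm. 9 / Cor. 9.1 [HartmanisStearns1965].
  doi:10.1090/S0002-9947-1965-0170805-7
* S. Arora, B. Barak, *Computational Complexity: A Modern Approach*, CUP 2009, Thm. 1.9, §1.4.1,
  Thm. 3.1 [AroraBarakCC2009]. doi:10.1017/cbo9780511804090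
-/

namespace Literature.Computability.Complexity

open _root_.Computability Turing Function

/-! ### Flat programs with the input on register `0` -/

namespace TM2Flat

open ACom

/-- **Every machine is a flat binary program reading its input off register `0`** (the normal
form `exists_aprogFin_of_outputsWithin` with the registers renumbered so that the input stack is
register `0`), with linear overhead. [cite: AroraBarakCC2009, §1.3–1.4 (Claims 1.5–1.6)] -/
theorem exists_aprogFin0_of_outputsWithin (M : TM2ComputableAux Bool Bool) :
    ∃ (K : ℕ) (P : AProg Bool (Fin (K + 1))) (out : Fin (K + 1)) (e : ℕ), ∀ (l l' : List Bool) (m : ℕ),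
      M.OutputsWithin l l' m → ∃ t ≤ e * (m + l.length + l'.length) + e,
        P.step^[t] ⟨0, AStore.single 0 l⟩ = ⟨P.length, AStore.single out l'⟩ := by
  classical
  obtain ⟨nK, P, k₀, k₁, e, hP⟩ := exists_runs_of_outputsWithin M
  let f : Reg nK → Fin (nK + 1 + 1) := (Equiv.swap 0 (regNum nK (.stk k₀))) ∘ regNum nK
  have hf : Injective f := (Equiv.injective _).comp (regNum_injective nK)
  have hf0 : f (.stk k₀) = 0 := by simp [f, Equiv.swap_apply_right]
  refine ⟨nK + 1, (P.map f).compile, f (.stk k₁), e, fun l l' m h => ?_⟩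
  have hR := (hP l l' m h).map hf (AStore.single (f (.stk k₀)) l) (fun i => single_comp_apply hf _ _ i)
  rw [graft_single hf, hf0] at hR
  obtain ⟨t, ht, hex⟩ := hR
  exact ⟨t, ht, by rw [length_compile]; exact hex.compile_iterate⟩

end TM2Flat

/-! ### The interpreter is correct with quadratic overhead -/

namespace UDet

/-- The arithmetic of the quadratic overhead: with `J ≤ A (t + n + 1) + A` simulated steps,
`interpCost n J ≤ 400 (A + 1)² (t + n)² + 400 (A + 1)²`. [folklore] -/
theorem interpCost_le {A t n J : ℕ} (hJ : J ≤ A * (t + n + 1) + A) :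
    interpCost n J ≤ 400 * (A + 1) ^ 2 * (t + n) ^ 2 + 400 * (A + 1) ^ 2 := by
  unfold interpCost
  set u := t + n with hu
  have hJ' : J ≤ A * u + 2 * A := by rw [hu]; nlinarith
  have hn : n ≤ u := by omega
  have h1 : J * (87 * n + 15 * J + 66) ≤ (A * u + 2 * A) * (87 * u + 15 * (A * u + 2 * A) + 66) :=
    Nat.mul_le_mul hJ' (by nlinarith)
  have hu2 : u ≤ u ^ 2 + 1 := by
    rcases Nat.eq_zero_or_pos u with h | h
    · simp [h]
    · nlinarith
  have key : (A * u + 2 * A) * (87 * u + 15 * (A * u + 2 * A) + 66) + 54 * u + 36 ≤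
      400 * (A + 1) ^ 2 * u ^ 2 + 400 * (A + 1) ^ 2 := by
    have e1 : (A * u + 2 * A) * (87 * u + 15 * (A * u + 2 * A) + 66) + 54 * u + 36 =
        (15 * A ^ 2 + 87 * A) * u ^ 2 + (60 * A ^ 2 + 240 * A + 54) * u + (60 * A ^ 2 + 132 * A + 36) := by ring
    rw [e1]
    have e2 : (60 * A ^ 2 + 240 * A + 54) * u ≤ (60 * A ^ 2 + 240 * A + 54) * (u ^ 2 + 1) :=
      Nat.mul_le_mul_left _ hu2
    nlinarith [e2, Nat.zero_le (u ^ 2), Nat.zero_le A]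
  omega

/-- **The interpreter is correct** in the sense of `FuelledRun.Interprets`: for every machine `M`,
with the header `e = hdr (K + 2) out (toUProg P)` of its flat binary program `P` (input register
`0`, `K + 1` registers, plus the dummy register of `toUProg`), on `x = ⟨e, pad⟩` the interpreter
answers `¬ b` within `κ₀ (t + |x|)² + κ₀` cost units whenever `M` outputs `b` on `x` within `t`
steps — the relaxed efficient universal machine (quadratic overhead).
[cite: AroraBarakCC2009, Thm. 1.9 (relaxed version) and Thm. 3.1 (proof)] -/
theorem interprets : FuelledRun.Interprets interp DR.X DR.ans := by
  intro M
  obtain ⟨K, PA, out, A, hP⟩ := TM2Flat.exists_aprogFin0_of_outputsWithin M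
  refine ⟨hdr (K + 1 + 1) out.val (UFlat.toUProg PA), 400 * (A + 1) ^ 2, fun pad b t hM => ?_⟩
  set P := UFlat.toUProg PA with hPdef
  set x := boolPair (hdr (K + 1 + 1) out.val P) pad with hx
  have henc : encodeBool b = [b] := by cases b <;> rfl
  rw [henc] at hM
  obtain ⟨t', ht', hrun⟩ := hP x [b] t hM
  set c₀ : ACfg Bool (Fin (K + 1)) := ⟨0, AStore.single 0 x⟩ with hc₀
  obtain ⟨J, hJt, hin, hhalt, hJeq⟩ := FlatFuel.exists_haltTime PA c₀ t' (by rw [hrun])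
  -- the uniform run
  have hunif : ∀ m, (UFlat.ustep P)^[m] (0, UFlat.initStore 0 x) = ((PA.step^[m] c₀).pc, UFlat.ext (PA.step^[m] c₀).regs) := by
    intro m
    have := UFlat.iterate_ustep_toUProg PA m c₀
    rw [hc₀] at this ⊢
    simpa [UFlat.ext_single] using this
  have hlen : P.length = PA.length := UFlat.length_toUProg PA
  have hin' : ∀ m < J, ((UFlat.ustep P)^[m] (0, UFlat.initStore 0 x)).1 < P.length := fun m hm => by
    rw [hunif, hlen]; exact hin m hm
  have hhalt' : P.length ≤ ((UFlat.ustep P)^[J] (0, UFlat.initStore 0 x)).1 := by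
    rw [hunif, hlen]; exact hhalt
  have hb : ((UFlat.ustep P)^[J] (0, UFlat.initStore 0 x)).2 out.val = b :: [] := by
    rw [hunif, hJeq, hrun]
    simp
  have hK : ∀ i ∈ P, i.k < K + 1 + 1 := fun i hi => UFlat.k_lt_of_mem_toUProg hi
  obtain ⟨s', hs', hR⟩ := runs_interp P (K + 1 + 1) out.val hK (by omega) (by have := out.isLt; omega) pad J
    hin' hhalt' b [] hb
  refine ⟨s'.store, ?_, by rw [store_ans, hs', FuelledRun.readout_cons]⟩
  rw [single_X]
  refine hR.mono (interpCost_le ?_)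
  calc J ≤ t' := hJt
    _ ≤ A * (t + x.length + [b].length) + A := ht'
    _ = A * (t + x.length + 1) + A := by simp

end UDet

/-! ### The theorem -/

/-- **The deterministic time hierarchy theorem** (discharge of `time_hierarchy`): for
time-constructible `T`, `U` with `T(n)² / U(n) → 0`, `DTIME T ⊂ DTIME U`.
[cite: HartmanisStearns1965, Thm. 9 / Cor. 9.1] -/
theorem time_hierarchy_holds : time_hierarchy :=
  FuelledRun.time_hierarchy_of_interpreter UDet.interp UDet.DR.X UDet.DR.ans UDet.interprets

end Literature.Computability.Complexity
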